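import Summits.BirchSwinnertonDyer.BirchSwinnertonDyer.Theorems.Rank2ObservatoryRank3TameTwoCensus
import Literature.NumberTheory.DiophantineGeometry.ConductorExponentZeroProofs
import Literature.NumberTheory.DiophantineGeometry.ConductorMultiplicativeProofs
import Literature.NumberTheory.DiophantineGeometry.ConductorAdditiveProofs
import Literature.NumberTheory.DiophantineGeometry.ConductorExponentLeTwoProofs
import Literature.NumberTheory.DiophantineGeometry.ConductorFactorizationProofs
import HarnessLib

/-!
# Rank-2 observatory (b2b-bsdr2, cert-2 gen 6): the conductor of the rank-3 census rows with the
# five conductor-exponent facts DISCHARGED — `N_E = N` hypothesis-free for the 5347 rows tame at 2 and 3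

HONEST FRAMING: per-curve certified theorems and census instruments; no claim on BSD in rank ≥ 2.

The conductor certificates of gen 5 (`Rank2ObservatoryConductorCert`, `…Rank3ConductorCensus`,
`…Rank3TameCensus`) and gen 6 (`…ConductorCert3`, `…Rank3ConductorCensus3`, `…Rank3TameTwoCensus`)
prove `conductorNorm ℤ E_r = r.N` modulo FIVE named facts on conductor exponents over `ℚ` —
`h0 : conductorExponent_eq_zero_iff` (`f_v = 0 ↔` good), `h1 : conductorExponent_eq_one_iff`
(`f_v = 1 ↔` multiplicative), `h2 : two_le_conductorExponent_iff` (`2 ≤ f_v ↔` additive),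
`h5 : conductorExponent_le_two_of_five_le_natGenerator` (`f_p ≤ 2` for `p ≥ 5`),
`hf : factorization_conductorNorm` (`N_E = ∏ p ^ f_p`) — plus, for the rows additive at `3`, the
Table II fact `h3 : conductorExponent_eq_tableConductorExponentThree` (Rizzo 2003).  ALL FIVE of
`h0 h1 h2 h5 hf` are THEOREMS of the tree's Literature (Tate's algorithm over a complete DVR with
perfect residue field and Ogg's formula as the definition of `conductorExponent`):
`WeierstrassCurve.conductorExponent_eq_zero_iff_holds` (`ConductorExponentZeroProofs`),
`…conductorExponent_eq_one_iff_holds` (`ConductorMultiplicativeProofs`),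
`…two_le_conductorExponent_iff_holds` (`ConductorAdditiveProofs`),
`…conductorExponent_le_two_of_five_le_natGenerator_holds` (`ConductorExponentLeTwoProofs`),
`…factorization_conductorNorm_holds` (`ConductorFactorizationProofs`).  This file plugs them in:

* `RNCert.conductorNorm_eq_conductor_holds` / `RNCert3.conductorNorm_eq_conductor3_holds` — the
  certificate soundness theorems with only `check`, `tame` (and `h3` for the place `3`) left;
* `Rank3Row.tameAtThree` (`3 ∤ Δ ∨ 3 ∤ c₄` on the integer model), the kernel walk `tame3Walk`
  (`rank3_tame3Walk`: every census row WITHOUT a gen-5 certificate is NOT tame at `3`) and the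
  kernel count `rank3Table_tame23_count : #{rows tame at 2 and at 3} = 5347`;
* **`Rank3Row.conductorNorm_eq_of_mem_of_tame23 : r ∈ rank3Table → r.tameAtTwo → r.tameAtThree →
  conductorNorm ℤ E_r = r.N` — NO named fact, NO hypothesis beyond membership and the two Booleans**
  (5347 rows), and `Rank3Row.conductorNorm_eq_of_mem_of_tameAtTwo_holds : r ∈ rank3Table →
  r.tameAtTwo → (h3) → conductorNorm ℤ E_r = r.N` (6463 rows, the single named fact `h3`);
* the census headlines `Rank3Row.rank3_lderiv_eq_zero_of_mem_of_tame23` /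
  `Rank3Row.rank3_lderiv_eq_zero_of_mem_of_tameAtTwo` (`hlow`, `hmin` gone; `hw` modulo `hKD`/`hR`;
  `hN` gone resp. modulo `h3`);
* hypothesis-free self-tests: `N(5077a1) = 5077`, `N(27747c1)` needs `h3` only.

The 3024 rows ADDITIVE AT `2` keep `hN` as a hypothesis (the conductor exponent at `2` would need
Tate's algorithm run on each equation, or Table III of Rizzo 2003 — not done here).

References: J. H. Silverman, *Advanced Topics in the Arithmetic of Elliptic Curves*, GTM 151 (1994),
IV.9.4 (Tate's algorithm), IV.10.2, IV.10.4, IV.11.1 (Ogg's formula) [Silverman1994]; J. H. Silverman,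
*The Arithmetic of Elliptic Curves*, 2nd ed. (2009), VII.5.1, C.16 [SilvermanAEC2009]; O. Rizzo,
Compositio Math. 136 (2003), Table II [Rizzo2003]; J. E. Cremona, *Algorithms for Modular Elliptic
Curves*, 2nd ed. (1997), Tables [CremonaAlgorithms1997]; B. H. Gross, in *L-functions and Arithmetic*,
LMS LN 153 (1991) [GrossLMS1991].
-/

namespace Summit.BirchSwinnertonDyer.BirchSwinnertonDyer.Rank2Observatory

open WeierstrassCurve IsDedekindDomain RootNumber Literature Literature.NumberTheory.EllipticCurves

/-! ### The certificate soundness theorems with the five conductor facts discharged -/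

section Certificates

variable {W₀ : WeierstrassCurve ℤ}

/-- Gen-5 conductor soundness (`conductorNorm_eq_conductor`) with `h0 h1 h2 h5 hf` supplied by the
tree's theorems: a checking, tame certificate gives `N(W₀ ⊗ ℚ) = c.conductor`.
[cite: Silverman1994, IV.10.2 and IV.10.4] -/
theorem RNCert.conductorNorm_eq_conductor_holds {c : RNCert} (hc : c.check W₀ = true)
    (ht : c.tame W₀ = true) : (W₀.baseChange ℚ).conductorNorm ℤ = c.conductor :=
  conductorNorm_eq_conductor hc ht (fun v ↦ conductorExponent_eq_zero_iff_holds v _)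
    (fun v ↦ conductorExponent_eq_one_iff_holds v _)
    (fun v ↦ two_le_conductorExponent_iff_holds v _)
    (fun v ↦ conductorExponent_le_two_of_five_le_natGenerator_holds _ v)
    (fun v ↦ factorization_conductorNorm_holds _ v)

/-- Gen-6 conductor soundness with the place `3` (`conductorNorm_eq_conductor3`) with `h0 h1 h2 h5 hf`
supplied by the tree's theorems: only the Table II fact `h3` remains.
[cite: Rizzo2003, Table II (p. 4), column v(N)] [cite: Silverman1994, IV.10.2 and IV.10.4] -/
theorem RNCert3.conductorNorm_eq_conductor3_holds {c : RNCert3} (hc : c.check W₀ = true)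
    (ht : c.tame W₀ = true)
    (h3 : (W₀.baseChange ℚ).conductorExponent_eq_tableConductorExponentThree) :
    (W₀.baseChange ℚ).conductorNorm ℤ = c.conductor W₀ :=
  conductorNorm_eq_conductor3 hc ht (fun v ↦ conductorExponent_eq_zero_iff_holds v _)
    (fun v ↦ conductorExponent_eq_one_iff_holds v _)
    (fun v ↦ two_le_conductorExponent_iff_holds v _)
    (fun v ↦ conductorExponent_le_two_of_five_le_natGenerator_holds _ v)
    (fun v ↦ factorization_conductorNorm_holds _ v) h3

end Certificates

/-- `N_E = N` for a gen-5 conductor-certified row — hypothesis-free. [cite: Silverman1994, IV.10.2 and IV.10.4] -/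
theorem Rank3Row.conductorNorm_eq_of_certified_holds {r : Rank3Row} (h : r.ConductorCertified) :
    r.curve.conductorNorm ℤ = r.N :=
  Rank3Row.conductorNorm_eq_of_certified h (fun v ↦ conductorExponent_eq_zero_iff_holds v _)
    (fun v ↦ conductorExponent_eq_one_iff_holds v _)
    (fun v ↦ two_le_conductorExponent_iff_holds v _)
    (fun v ↦ conductorExponent_le_two_of_five_le_natGenerator_holds _ v)
    (fun v ↦ factorization_conductorNorm_holds _ v)

/-- `N_E = N` for every rank-3 census row tame at `2`, modulo the single named fact `h3` (Table II's
`v(N)` column at `3`; vacuous in effect for the rows not additive at `3`, but uniform in the statement).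
[cite: Rizzo2003, Table II (p. 4), column v(N)] [cite: Silverman1994, IV.10.2 and IV.10.4] -/
theorem Rank3Row.conductorNorm_eq_of_mem_of_tameAtTwo_holds {r : Rank3Row} (hr : r ∈ rank3Table)
    (ht : r.tameAtTwo = true) (h3 : r.curve.conductorExponent_eq_tableConductorExponentThree) :
    r.curve.conductorNorm ℤ = r.N :=
  Rank3Row.conductorNorm_eq_of_mem_of_tameAtTwo hr ht (fun v ↦ conductorExponent_eq_zero_iff_holds v _)
    (fun v ↦ conductorExponent_eq_one_iff_holds v _)
    (fun v ↦ two_le_conductorExponent_iff_holds v _)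
    (fun v ↦ conductorExponent_le_two_of_five_le_natGenerator_holds _ v)
    (fun v ↦ factorization_conductorNorm_holds _ v) h3

/-! ### Rows tame at `3`: no named fact at all -/

/-- A row is TAME AT `3` if `3 ∤ Δ` or `3 ∤ c₄` of its integer model (good or multiplicative
reduction at `3`). [cite: SilvermanAEC2009, VII.5 Prop. 5.1] -/
def Rank3Row.tameAtThree (r : Rank3Row) : Bool :=
  !decide ((3 : ℤ) ∣ r.intModel.Δ) || !decide ((3 : ℤ) ∣ r.intModel.c₄)

/-- One pass over (rows, gen-5 certificate table): every row WITHOUT a gen-5 certificate is not tame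
at `3`. [folklore] -/
def tame3Walk : List Rank3Row → List (Option RNCert) → Bool
  | [], _ => true
  | _ :: _, [] => false
  | r :: rs, oc :: cs => (oc.isSome || !r.tameAtThree) && tame3Walk rs cs

/-- What the walk certifies, row by row. [folklore] -/
theorem not_tame3_of_tame3Walk :
    ∀ (rows : List Rank3Row) (certs : List (Option RNCert)), tame3Walk rows certs = true →
      ∀ (i : ℕ) (hi : i < rows.length), certs[i]? = some none → (rows[i]'hi).tameAtThree = false
  | [], _, _, i, hi, _ => absurd hi (Nat.not_lt_zero i)
  | _ :: _, [], h, _, _, _ => by simp [tame3Walk] at h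
  | r :: rs, oc :: cs, h, i, hi, hc => by
    simp only [tame3Walk, Bool.and_eq_true, Bool.or_eq_true] at h
    cases i with
    | zero =>
      simp only [List.getElem?_cons_zero, Option.some.injEq] at hc
      subst hc
      rcases h.1 with h1 | h1
      · simp at h1
      · simpa using h1
    | succ j =>
      simp only [List.getElem?_cons_succ] at hc
      exact not_tame3_of_tame3Walk rs cs h.2 j (by simpa using hi) hc

/-- KERNEL: the walk accepts the census (the `1550` rows without a gen-5 certificate are exactly the rows
additive at `3`). [cite: CremonaAlgorithms1997, Tables] -/
theorem rank3_tame3Walk : tame3Walk rank3Table rank3RNCerts = true := by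
  decide +kernel

/-- **`5347` of the `9487` rank-3 census rows are tame at `2` and at `3`** (kernel count; the gen-5
conductor census count `rank3Table_condCount`). [cite: CremonaAlgorithms1997, Tables] -/
theorem rank3Table_tame23_count :
    rank3Table.countP (fun r ↦ r.tameAtTwo && r.tameAtThree) = 5347 := by
  decide +kernel

/-- **`N_E = N` with NO named fact for every rank-3 census row tame at `2` and at `3`** (5347 rows):
such a row has a gen-5 certificate (`rank3_tame3Walk`), which checks (`rank3Table_rnCheck`) and is
tame on the row (`RNCert.tame_of_check`), and certificate soundness holds outright
(`RNCert.conductorNorm_eq_conductor_holds`). [cite: Silverman1994, IV.10.2 and IV.10.4]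
[cite: CremonaAlgorithms1997, Tables] -/
theorem Rank3Row.conductorNorm_eq_of_mem_of_tame23 {r : Rank3Row} (hr : r ∈ rank3Table)
    (ht2 : r.tameAtTwo = true) (ht3 : r.tameAtThree = true) : r.curve.conductorNorm ℤ = r.N := by
  obtain ⟨i, hi, rfl⟩ := List.getElem_of_mem hr
  have ht' := Rank3Row.not_dvd_of_tameAtTwo ht2
  have hi' : i < rank3RNCerts.length := by
    rw [rank3RNCerts_length]; rw [rank3Table_length] at hi; exact hi
  rcases h : rank3RNCerts[i]'hi' with _ | c
  · have hn : rank3RNCerts[i]? = some none := by rw [List.getElem?_eq_getElem hi', h]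
    have := not_tame3_of_tame3Walk _ _ rank3_tame3Walk i hi hn
    rw [this] at ht3
    exact absurd ht3 Bool.false_ne_true
  · have hc : rank3RNCerts[i]? = some (some c) := by rw [List.getElem?_eq_getElem hi', h]
    exact Rank3Row.conductorNorm_eq_of_certified_holds
      (Rank3Row.conductorCertified_of_idx hi hc (RNCert.tame_of_check
        (check_of_rnRowsCheck _ _ rank3Table_rnCheck i hi c hc) ht'))

/-! ### Census headlines -/

/-- **`L′(E,1) = 0` over `K = ℚ(√D)` for every rank-3 census row tame at `2` and at `3`** with `hlow`,
`hmin`, `hN` discharged outright and `hw` modulo the named root-number facts `hKD`/`hR`; remaining: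
modularity `hE`, Gross–Zagier–Kolyvagin over `K` (`hGZKK`), `K` (`hK`, `hdK`), the twist value `hLD`.
[cite: GrossLMS1991, (1.1) and Thm. 1.3] -/
theorem Rank3Row.rank3_lderiv_eq_zero_of_mem_of_tame23 {r : Rank3Row} (hr : r ∈ rank3Table)
    (ht2 : r.tameAtTwo = true) (ht3 : r.tameAtThree = true) (K : Type) [Field K] [NumberField K]
    (hE : WeierstrassCurve.hasEntireLFunction_rat)
    (hGZKK : mordellWeilRank_eq_one_of_LDerivEK_ne_zero r.curve K)
    (hK : IsImaginaryQuadratic K) (hdK : NumberField.discr K = r.D)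
    (hKD : r.curve.rootNumber_eq_neg_finprod_tableLocalRootNumberAt')
    (hR : r.curve.rootNumber_eq_neg_finprod_fullTableLocalRootNumberAt)
    (hLD : (r.curve.quadraticTwist (r.D : ℚ)).entireLFunction 1 ≠ 0) :
    deriv r.curve.entireLFunction 1 = 0 :=
  Rank3Row.rank3_lderiv_eq_zero_kernel_wm hr K hE hGZKK
    (Rank3Row.conductorNorm_eq_of_mem_of_tame23 hr ht2 ht3) hK hdK hKD hR hLD

/-- **`L′(E,1) = 0` over `K = ℚ(√D)` for every rank-3 census row tame at `2`**: as above with `hN`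
modulo the single Table II fact `h3`. [cite: GrossLMS1991, (1.1) and Thm. 1.3]
[cite: Rizzo2003, Table II (p. 4), column v(N)] -/
theorem Rank3Row.rank3_lderiv_eq_zero_of_mem_of_tameAtTwo {r : Rank3Row} (hr : r ∈ rank3Table)
    (ht2 : r.tameAtTwo = true) (K : Type) [Field K] [NumberField K]
    (hE : WeierstrassCurve.hasEntireLFunction_rat)
    (hGZKK : mordellWeilRank_eq_one_of_LDerivEK_ne_zero r.curve K)
    (h3 : r.curve.conductorExponent_eq_tableConductorExponentThree)
    (hK : IsImaginaryQuadratic K) (hdK : NumberField.discr K = r.D)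
    (hKD : r.curve.rootNumber_eq_neg_finprod_tableLocalRootNumberAt')
    (hR : r.curve.rootNumber_eq_neg_finprod_fullTableLocalRootNumberAt)
    (hLD : (r.curve.quadraticTwist (r.D : ℚ)).entireLFunction 1 ≠ 0) :
    deriv r.curve.entireLFunction 1 = 0 :=
  Rank3Row.rank3_lderiv_eq_zero_kernel_wm hr K hE hGZKK
    (Rank3Row.conductorNorm_eq_of_mem_of_tameAtTwo_holds hr ht2 h3) hK hdK hKD hR hLD

/-! ### Self-tests -/

/-- Row `0` (`5077a1`) is tame at `2` and at `3`. [cite: CremonaAlgorithms1997, Tables] -/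
theorem tame23_row0 :
    (rank3Table[0]'(by rw [rank3Table_length]; decide)).tameAtTwo = true ∧
      (rank3Table[0]'(by rw [rank3Table_length]; decide)).tameAtThree = true := by
  constructor <;> decide +kernel

/-- **`N(5077a1) = 5077`, hypothesis-free** (row `0` of the census). [cite: CremonaAlgorithms1997, Tables] -/
theorem conductorNorm_row0 :
    (rank3Table[0]'(by rw [rank3Table_length]; decide)).curve.conductorNorm ℤ = 5077 := by
  have hN : (rank3Table[0]'(by rw [rank3Table_length]; decide)).N = 5077 := by decide +kernel
  rw [← hN]
  exact Rank3Row.conductorNorm_eq_of_mem_of_tame23 (List.getElem_mem _) tame23_row0.1 tame23_row0.2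

end Summit.BirchSwinnertonDyer.BirchSwinnertonDyer.Rank2Observatory
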